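import Summits.KontsevichZagierPeriods.KontsevichZagierPeriods.Theses.HurwitzMicroSectors
import Summits.KontsevichZagierPeriods.KontsevichZagierPeriods.Theorems.HurwitzMicroSectorsNormalFormPrinciplePiBoxTransfer
import Summits.KontsevichZagierPeriods.KontsevichZagierPeriods.Theorems.HurwitzMicroSectorsNormalFormPrincipleVariants2359

/-! TTRL-lite variant V2327 of stmt-KontsevichZagierPeriods-3869

Variant V2327 = `stub_boxRigidity` (BoxRigidity: two box-rational representations — domain the open
unit box, integrand `p/q` over `ℚ` — with equal values are KZ-equivalent) under the JOINT small-case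
move `bound_nat:m≤8; bound_nat:m'≤4`. Verdict of the attempt seat: **open** — this file is the
exact-strength certificate, not a proof of the variant. A joint bound `m ≤ j, m' ≤ k` pins the leaf
to ONE dimension, `max j k` (`boxRigidityLe_iff_boxVanishing`, file `…Variants2239`): V2327 is
EQUIVALENT to **BoxVanishing in dimension `8`** — every box-rational representation on `(0,1)⁸` of
value `0` is a Kontsevich–Zagier relation (`stub_boxRigidity_var2327_iff_boxVanishing_eight`: `⇒`
compare a representation of value `0` with the zero representation on the `0`-box, itself a relation;
`⇐` pad both sides to `(0,1)⁸` by unit intervals and subtract on the common box, value `0` by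
soundness). Hence the bound `m' ≤ 4` is idle: V2327 is literally equivalent to the recorded-open
sibling V2359 (`m' = 3`, `m ≤ 8`; `stub_boxRigidity_var2327_iff_var2359`) and to BoxRigidity with
BOTH dimensions `≤ 8` (`stub_boxRigidity_var2327_iff_boxRigidityLe_eight`). Already its
dimension-`2` consequence (`boxVanishing_two_of_stub_boxRigidity_var2327`) would decide every
`ℚ`-linear relation among the periods `∫∫_{(0,1)²} p/q` (Catalan's `G`, `π log 2`, `log² 2`,
`Li₂`/Clausen values) in favour of the calculus — no argument in the tree or in print proves that;
conversely `KontsevichZagierPeriods → V2327` (`stub_boxRigidity_var2327_of_statement`), so a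
refutation of the variant would refute Conjecture 1 for the tree's calculus (whose only invariant in
the tree is `eval`). The proved two-sided frontier is `max m m' ≤ 1` (`boxRigidity_of_le_one`, Baker).
Source: M. Kontsevich, D. Zagier, *Periods* (2001), §1.2 Conjecture 1 and rules 1)–3).
Pure proof file, no definitions. -/

-- `Summit.<Summit>.<Problem>` is the tree's mandated summit-side namespace (CONVENTIONS §2); for this
-- single-conjunct summit the two coincide, so the duplicate is deliberate.
set_option linter.dupNamespace false

namespace Summit.KontsevichZagierPeriods.KontsevichZagierPeriods.Theorems

open MeasureTheory Set
open Literature.NumberTheory.Transcendental Literature.NumberTheory.Transcendental.KZ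
open Summit.KontsevichZagierPeriods.KontsevichZagierPeriods.Theses.HurwitzMicroSectors
open Summit.KontsevichZagierPeriods.HurwitzMicroSectors.NormalFormPrinciple.PiBox

/-! ## The variant V2327 itself: exact strength -/

/-- **V2327 ⟺ BoxVanishing in dimension `8`** (every box-rational representation on `(0,1)⁸` of value
`0` is a relation): Conjecture 1 for box-rational periods of dimension `8`, open — the joint bound
`m ≤ 8, m' ≤ 4` is the single dimension `max 8 4 = 8` (`boxVanishing_of_boxRigidityLe`,
`boxRigidityLe_of_boxVanishing`). [cite: KontsevichZagier2001, §1.2 Conjecture 1] -/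
theorem stub_boxRigidity_var2327_iff_boxVanishing_eight :
    (∀ (m m' : ℕ) (N : IntegralRep m) (N' : IntegralRep m'), m' ≤ 4 → m ≤ 8 → N.domain = {x | ∀ i, x i ∈ Set.Ioo (0:ℝ) 1} → N.IsRational → N'.domain = {x | ∀ i, x i ∈ Set.Ioo (0:ℝ) 1} → N'.IsRational → N.value = N'.value → Equivalent N N') ↔
    (∀ N : IntegralRep 8, N.domain = {x | ∀ i, x i ∈ Set.Ioo (0:ℝ) 1} → N.IsRational →
      N.value = 0 → of N ∈ relations) :=
  ⟨fun h => boxVanishing_of_boxRigidityLe le_rfl h,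
    fun h => boxRigidityLe_of_boxVanishing le_rfl (by norm_num) h⟩

/-- **V2327 ⟺ V2359** (`m' = 3`, `m ≤ 8`, recorded open): both are BoxVanishing in dimension `8`, so
the two programmatic moves produce the same proposition up to `↔`.
[cite: KontsevichZagier2001, §1.2 Conjecture 1] -/
theorem stub_boxRigidity_var2327_iff_var2359 :
    (∀ (m m' : ℕ) (N : IntegralRep m) (N' : IntegralRep m'), m' ≤ 4 → m ≤ 8 → N.domain = {x | ∀ i, x i ∈ Set.Ioo (0:ℝ) 1} → N.IsRational → N'.domain = {x | ∀ i, x i ∈ Set.Ioo (0:ℝ) 1} → N'.IsRational → N.value = N'.value → Equivalent N N') ↔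
    (∀ (m : ℕ) (N : IntegralRep m) (N' : IntegralRep 3), m ≤ 8 → N.domain = {x | ∀ i, x i ∈ Set.Ioo (0:ℝ) 1} → N.IsRational → N'.domain = {x | ∀ i, x i ∈ Set.Ioo (0:ℝ) 1} → N'.IsRational → N.value = N'.value → Equivalent N N') :=
  stub_boxRigidity_var2327_iff_boxVanishing_eight.trans
    stub_boxRigidity_var2359_iff_boxVanishing_eight.symm

/-- **V2327 ⟺ BoxRigidity with both dimensions `≤ 8`**: the bound `m' ≤ 4` is idle next to `m ≤ 8`
(the honest strength of the variant: Conjecture 1 for all pairs of rational integrands over `ℚ` on the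
open unit boxes of dimension at most `8`). [cite: KontsevichZagier2001, §1.2 Conjecture 1] -/
theorem stub_boxRigidity_var2327_iff_boxRigidityLe_eight :
    (∀ (m m' : ℕ) (N : IntegralRep m) (N' : IntegralRep m'), m' ≤ 4 → m ≤ 8 → N.domain = {x | ∀ i, x i ∈ Set.Ioo (0:ℝ) 1} → N.IsRational → N'.domain = {x | ∀ i, x i ∈ Set.Ioo (0:ℝ) 1} → N'.IsRational → N.value = N'.value → Equivalent N N') ↔
    (∀ (m m' : ℕ) (N : IntegralRep m) (N' : IntegralRep m'), m ≤ 8 → m' ≤ 8 →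
      N.domain = {x | ∀ i, x i ∈ Set.Ioo (0:ℝ) 1} → N.IsRational →
      N'.domain = {x | ∀ i, x i ∈ Set.Ioo (0:ℝ) 1} → N'.IsRational →
      N.value = N'.value → Equivalent N N') :=
  stub_boxRigidity_var2327_iff_var2359.trans stub_boxRigidity_var2359_iff_boxRigidityLe_eight

/-! ## Consequences in low dimension (why the variant is open) -/

/-- **V2327 ⇒ BoxVanishing in every dimension `≤ 8`** (BoxVanishing descends along padding,
`boxVanishing_mono`). [cite: KontsevichZagier2001, §1.2 Conjecture 1] -/
theorem boxVanishingLe_eight_of_stub_boxRigidity_var2327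
    (h : ∀ (m m' : ℕ) (N : IntegralRep m) (N' : IntegralRep m'), m' ≤ 4 → m ≤ 8 → N.domain = {x | ∀ i, x i ∈ Set.Ioo (0:ℝ) 1} → N.IsRational → N'.domain = {x | ∀ i, x i ∈ Set.Ioo (0:ℝ) 1} → N'.IsRational → N.value = N'.value → Equivalent N N') :
    ∀ (m : ℕ) (N : IntegralRep m), m ≤ 8 → N.domain = {x | ∀ i, x i ∈ Set.Ioo (0:ℝ) 1} →
      N.IsRational → N.value = 0 → of N ∈ relations :=
  fun _ N hm => boxVanishing_mono hm (stub_boxRigidity_var2327_iff_boxVanishing_eight.1 h) N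

/-- **V2327 ⇒ BoxVanishing in dimension `2`** — the first open dimension: every `ℚ`-linear relation
among the box periods `∫∫_{(0,1)²} p/q` (`π log 2`, `log² 2`, Catalan's `G`, `Li₂` and Clausen values, …)
would be a KZ relation. [cite: KontsevichZagier2001, §1.2 Conjecture 1] -/
theorem boxVanishing_two_of_stub_boxRigidity_var2327
    (h : ∀ (m m' : ℕ) (N : IntegralRep m) (N' : IntegralRep m'), m' ≤ 4 → m ≤ 8 → N.domain = {x | ∀ i, x i ∈ Set.Ioo (0:ℝ) 1} → N.IsRational → N'.domain = {x | ∀ i, x i ∈ Set.Ioo (0:ℝ) 1} → N'.IsRational → N.value = N'.value → Equivalent N N')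
    (N : IntegralRep 2) (hNd : N.domain = {x | ∀ i, x i ∈ Set.Ioo (0:ℝ) 1}) (hNr : N.IsRational)
    (hv : N.value = 0) : of N ∈ relations :=
  boxVanishingLe_eight_of_stub_boxRigidity_var2327 h 2 N (by norm_num) hNd hNr hv

/-! ## The other side: the variant is implied by the leaf and by the Summit -/

/-- **The parent leaf ⇒ V2327** (specialisation; the converse is not claimed — the parent is
BoxVanishing in ALL dimensions). [cite: KontsevichZagier2001, §1.2 Conjecture 1] -/
theorem stub_boxRigidity_var2327_of_parent
    (h : ∀ (m m' : ℕ) (N : IntegralRep m) (N' : IntegralRep m'), N.domain = {x | ∀ i, x i ∈ Set.Ioo (0:ℝ) 1} → N.IsRational → N'.domain = {x | ∀ i, x i ∈ Set.Ioo (0:ℝ) 1} → N'.IsRational → N.value = N'.value → Equivalent N N') :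
    ∀ (m m' : ℕ) (N : IntegralRep m) (N' : IntegralRep m'), m' ≤ 4 → m ≤ 8 → N.domain = {x | ∀ i, x i ∈ Set.Ioo (0:ℝ) 1} → N.IsRational → N'.domain = {x | ∀ i, x i ∈ Set.Ioo (0:ℝ) 1} → N'.IsRational → N.value = N'.value → Equivalent N N' :=
  fun m m' N N' _ _ => h m m' N N'

/-- **`KontsevichZagierPeriods ⇒ V2327`**: the variant is a special case of Conjecture 1 for the
tree's calculus (`leaves_of_statement`) — a refutation of the variant would refute the Summit.
[cite: KontsevichZagier2001, §1.2 Conjecture 1] -/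
theorem stub_boxRigidity_var2327_of_statement (h : _root_.KontsevichZagierPeriods) :
    ∀ (m m' : ℕ) (N : IntegralRep m) (N' : IntegralRep m'), m' ≤ 4 → m ≤ 8 → N.domain = {x | ∀ i, x i ∈ Set.Ioo (0:ℝ) 1} → N.IsRational → N'.domain = {x | ∀ i, x i ∈ Set.Ioo (0:ℝ) 1} → N'.IsRational → N.value = N'.value → Equivalent N N' :=
  stub_boxRigidity_var2327_of_parent (leaves_of_statement h).1

end Summit.KontsevichZagierPeriods.KontsevichZagierPeriods.Theorems
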